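import Summits.ABC.ABC.Theses.IsogenyGlueCongruence

/-!
# Stub `stub_primePowers_of_gluing` (DEPTH from the lever) of the line `Sketch` of crux stmt-ABC-2046

What is proved. The DEPTH half of the polynomial modular-degree statement `P` for semistable
curves, routed through the route's lever at prime powers — verbatim the registered stub
`stub_primePowers_of_gluing` of skeleton v2 of the line `Sketch` of crux B
(`PolyDegreeOfBoundedPrimes`, route IsogenyGlueCongruence):

> U^e → `ModularJacobianMultipliers` → `SemistableHeightPolyBound` → DEPTH∃,

where
* U^e (first hypothesis, anonymous) is the gluing bound at prime powers: for an elliptic `W/ℚ`,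
  abelian varieties `E`, `B` over `ℚ` with a Galois-equivariant `E(ℚ̄) ≃ W(ℚ̄)`, a prime `ℓ` and
  `k ≥ 1`, if a non-zero `E`-multiplier of `B` exists and `ℓ ^ k` divides EVERY `E`-multiplier
  `n` of `B` (`α ≫ β = n • 𝟙 E`), then `ℓ ^ k ≤ C · (dim B · max(1, h_F(W)))^κ` with absolute
  constants `κ ≥ 0`, `C` (`h_F = W.stableFaltingsHeight`);
* `ModularJacobianMultipliers` (route item stmt-ABC-13920): for a semistable globally minimal `W`
  of conductor `N = W.conductorNorm ℤ` there are a modular parametrisation datum `D` at level `N`,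
  abelian varieties `E`, `J`, a Galois-equivariant `e : E(ℚ̄) ≃ W(ℚ̄)`, the bound `dim J ≤ N²`,
  a non-zero `E`-multiplier of `J`, and `(deg D : ℤ) ∣ n` for every `E`-multiplier `n` of `J`;
* `SemistableHeightPolyBound` (route item stmt-ABC-13918): `∃ c, h_F(W) ≤ c · N²` for such `W`;
* DEPTH∃ (conclusion): `∃ κ' C', ∀ W …, ∃ D, ∀ ℓ prime, ℓ ^ v_ℓ(deg D) ≤ C' · N ^ κ'`.

Proof. Take `κ' = 4κ` and `C' = max (max C 0 · (max 1 c)^κ) 1`. For `W` take the `D, E, J, e`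
of the Jacobian item; for a prime `ℓ` put `v = v_ℓ(deg D)`. If `v = 0` then
`ℓ^0 = 1 ≤ C' · N^{4κ}` because `C' ≥ 1`, `N ≥ 1` (`NeZero`) and `4κ ≥ 0`. If `v ≥ 1` then
`ℓ^v ∣ deg D` (`Nat.ordProj_dvd`) and `(deg D : ℤ) ∣ n` for every multiplier `n`, so U^e with
`k = v` gives `ℓ^v ≤ C · X^κ` with `X = dim J · max(1, h_F(W)) ≤ N² · (max 1 c · N²) =
max 1 c · N⁴`; monotonicity of `x ↦ x^κ` on `[0, ∞)` for `κ ≥ 0` (`Real.rpow_le_rpow`),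
`Real.mul_rpow` and `Real.rpow_natCast_mul` give
`ℓ^v ≤ max C 0 · (max 1 c)^κ · N^{4κ} ≤ C' · N^{4κ}`.

Sources: folklore bookkeeping (Mathlib only: `Real.rpow`, `Nat.factorization`); the same
computation as the accepted prime-size analogue
`Summit.ABC.ABC.Theorems.degreePrimesOfGluingBound_proof`. No literature fact is used. This file
supports `stmt-ABC-2046`: its only theorem is, verbatim, the registered stub
`stub_primePowers_of_gluing` of the skeleton of the line `Sketch`.
-/

-- single-conjunct summit ABC: the duplicate ABC.ABC is mandated (CONVENTIONS §2)
set_option linter.dupNamespace false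

namespace Summit.ABC.ABC.Theorems

/-- **DEPTH from the lever at prime powers** (stub `stub_primePowers_of_gluing` of the line
`Sketch`, crux stmt-ABC-2046): the prime-power gluing bound U^e, the route item
`ModularJacobianMultipliers` and the route item `SemistableHeightPolyBound` give, for every
semistable globally minimal elliptic `W/ℚ` of conductor `N = W.conductorNorm ℤ`, a modular
parametrisation datum `D` at level `N` each of whose prime powers satisfies
`ℓ ^ v_ℓ(deg D) ≤ C' · N ^ κ'`, with `κ' = 4κ` and `C' = max (max C 0 * (max 1 c) ^ κ) 1` built
from the constants `κ, C` of U^e and `c` of the height bound.  Proof: take the Jacobian datum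
`D` with its `E, J, e`; for `v = v_ℓ(deg D) = 0` use `C' ≥ 1`, `N ≥ 1`, `4κ ≥ 0`; for `v ≥ 1`,
`ℓ^v ∣ deg D` (`Nat.ordProj_dvd`) and `(deg D : ℤ) ∣ n` for every `E`-multiplier `n` of `J`
give `(ℓ^v : ℤ) ∣ n` (`Int.natCast_dvd_natCast`), so U^e applies with `k = v`; then
`dim J · max 1 h_F(W) ≤ N² · (max 1 c · N²) = max 1 c · N⁴` and `Real.rpow_le_rpow`
(base `≥ 0`, `κ ≥ 0`), `Real.mul_rpow`, `Real.rpow_natCast_mul` finish. [folklore] -/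
theorem stub_primePowers_of_gluing : (∃ κ C : ℝ, 0 ≤ κ ∧ ∀ (W : WeierstrassCurve ℚ) [W.IsElliptic] (E B : Literature.AlgebraicGeometry.Motives.AbelianVariety.{0} ℚ) (e : E.geomPoints ≃+ W.geomPoints), (∀ (σ : Field.absoluteGaloisGroup ℚ) (P : E.geomPoints), e (σ • P) = σ • e P) → ∀ ℓ k : ℕ, ℓ.Prime → 1 ≤ k → (∃ (α : E ⟶ B) (β : B ⟶ E) (n : ℤ), n ≠ 0 ∧ CategoryTheory.CategoryStruct.comp α β = n • CategoryTheory.CategoryStruct.id E) → (∀ (α : E ⟶ B) (β : B ⟶ E) (n : ℤ), CategoryTheory.CategoryStruct.comp α β = n • CategoryTheory.CategoryStruct.id E → ((ℓ ^ k : ℕ) : ℤ) ∣ n) → ((ℓ ^ k : ℕ) : ℝ) ≤ C * ((B.dim : ℝ) * max 1 W.stableFaltingsHeight) ^ κ) → Summit.ABC.ABC.Theses.IsogenyGlueCongruence.ModularJacobianMultipliers → Summit.ABC.ABC.Theses.IsogenyGlueCongruence.SemistableHeightPolyBound → ∃ κ C : ℝ, ∀ (W : WeierstrassCurve ℚ)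 [W.IsElliptic] [W.IsGloballyMinimal] [NeZero (W.conductorNorm ℤ)], W.IsSemistable ℤ → ∃ D : Literature.NumberTheory.EllipticCurves.ModularForms.ModularParametrizationData W (W.conductorNorm ℤ), ∀ ℓ : ℕ, ℓ.Prime → ((ℓ ^ (D.modularDegree).factorization ℓ : ℕ) : ℝ) ≤ C * (W.conductorNorm ℤ : ℝ) ^ κ := by
  intro hU hM hH
  obtain ⟨κ, C, hκ, hU⟩ := hU
  obtain ⟨c, hc⟩ := hH
  refine ⟨4 * κ, max (max C 0 * (max 1 c) ^ κ) 1, ?_⟩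
  intro W _ _ _ hW
  obtain ⟨D, E, J, e, he, hdim, hne, hdiv⟩ := hM W hW
  refine ⟨D, fun ℓ hℓ ↦ ?_⟩
  -- Step 1: bookkeeping in the base (as in `degreePrimesOfGluingBound_proof`).
  set N : ℝ := (W.conductorNorm ℤ : ℝ) with hNdef
  set X : ℝ := (J.dim : ℝ) * max 1 W.stableFaltingsHeight with hXdef
  have hN1 : (1 : ℝ) ≤ N := by
    have h : 1 ≤ W.conductorNorm ℤ := NeZero.one_le
    rw [hNdef]
    exact_mod_cast h
  have hN0 : (0 : ℝ) ≤ N := zero_le_one.trans hN1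
  have hN2 : (1 : ℝ) ≤ N ^ 2 := one_le_pow₀ hN1
  have hmc : (1 : ℝ) ≤ max 1 c := le_max_left _ _
  have hmc0 : (0 : ℝ) ≤ max 1 c := zero_le_one.trans hmc
  have hX0 : 0 ≤ X :=
    mul_nonneg (Nat.cast_nonneg _) (zero_le_one.trans (le_max_left _ _))
  have hmax : max 1 W.stableFaltingsHeight ≤ max 1 c * N ^ 2 := by
    refine max_le ?_ ?_
    · calc (1 : ℝ) = 1 * 1 := (mul_one 1).symm
        _ ≤ max 1 c * N ^ 2 := mul_le_mul hmc hN2 zero_le_one hmc0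
    · calc W.stableFaltingsHeight ≤ c * N ^ 2 := hc W hW
        _ ≤ max 1 c * N ^ 2 :=
          mul_le_mul_of_nonneg_right (le_max_right _ _) (pow_nonneg hN0 2)
  have hXle : X ≤ max 1 c * N ^ (4 : ℕ) := by
    calc X = (J.dim : ℝ) * max 1 W.stableFaltingsHeight := rfl
      _ ≤ N ^ 2 * (max 1 c * N ^ 2) :=
          mul_le_mul hdim hmax (zero_le_one.trans (le_max_left _ _)) (pow_nonneg hN0 2)
      _ = max 1 c * N ^ (4 : ℕ) := by ring
  have hrpow : X ^ κ ≤ (max 1 c * N ^ (4 : ℕ)) ^ κ := Real.rpow_le_rpow hX0 hXle hκ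
  have h4 : N ^ (4 * κ) = (N ^ (4 : ℕ)) ^ κ := by
    rw [← Real.rpow_natCast_mul hN0]
    norm_num
  have hsplit : (max 1 c * N ^ (4 : ℕ)) ^ κ = (max 1 c) ^ κ * N ^ (4 * κ) := by
    rw [Real.mul_rpow hmc0 (pow_nonneg hN0 4), h4]
  have hNκ1 : (1 : ℝ) ≤ N ^ (4 * κ) := Real.one_le_rpow hN1 (by positivity)
  have hNκ0 : (0 : ℝ) ≤ N ^ (4 * κ) := zero_le_one.trans hNκ1
  have hC'1 : (1 : ℝ) ≤ max (max C 0 * (max 1 c) ^ κ) 1 := le_max_right _ _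
  -- Step 2: case split on the exponent `v = v_ℓ(deg D)`.
  rcases Nat.eq_zero_or_pos ((D.modularDegree).factorization ℓ) with hv | hv
  · -- `v = 0`: `ℓ^0 = 1 ≤ C' · N^{4κ}`.
    rw [hv, pow_zero, Nat.cast_one]
    calc (1 : ℝ) = 1 * 1 := (mul_one 1).symm
      _ ≤ max (max C 0 * (max 1 c) ^ κ) 1 * N ^ (4 * κ) :=
          mul_le_mul hC'1 hNκ1 zero_le_one (zero_le_one.trans hC'1)
  · -- `v ≥ 1`: `ℓ^v ∣ deg D ∣ n` for every multiplier `n`, so U^e applies with `k = v`.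
    have hpd : ℓ ^ (D.modularDegree).factorization ℓ ∣ D.modularDegree :=
      Nat.ordProj_dvd _ _
    have hU1 : ((ℓ ^ (D.modularDegree).factorization ℓ : ℕ) : ℝ) ≤ C * X ^ κ :=
      hU W E J e he ℓ ((D.modularDegree).factorization ℓ) hℓ hv hne
        (fun α β n h ↦ (Int.natCast_dvd_natCast.mpr hpd).trans (hdiv α β n h))
    calc ((ℓ ^ (D.modularDegree).factorization ℓ : ℕ) : ℝ) ≤ C * X ^ κ := hU1
      _ ≤ max C 0 * X ^ κ :=
          mul_le_mul_of_nonneg_right (le_max_left _ _) (Real.rpow_nonneg hX0 κ)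
      _ ≤ max C 0 * ((max 1 c) ^ κ * N ^ (4 * κ)) := by
          rw [← hsplit]
          exact mul_le_mul_of_nonneg_left hrpow (le_max_right _ _)
      _ = (max C 0 * (max 1 c) ^ κ) * N ^ (4 * κ) := by ring
      _ ≤ max (max C 0 * (max 1 c) ^ κ) 1 * N ^ (4 * κ) :=
          mul_le_mul_of_nonneg_right (le_max_left _ _) hNκ0

end Summit.ABC.ABC.Theorems
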